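import Summits.KontsevichZagierPeriods.KontsevichZagierPeriods.Theorems.LinRedNormalFormArrangementNormalFormStubRebaseSimpleZeroNestedCone
import Summits.KontsevichZagierPeriods.KontsevichZagierPeriods.Theorems.LinRedNormalFormArrangementNormalFormStubRebaseSimpleZeroProduct

/-!
# Stub `stub_rebaseSimpleZeroTwo`, part `rebaseSimpleZero_nestedCommon` (crux `ArrangementNormalForm`,
line `janus-bands`) — brick `NestedTools`

Dictionary for the dissection of a CLEAN NESTED pair `A(y) < tᵢ < tⱼ < B(y)` over a
one-dimensional base `y` (literal class `GS 0 2`, simple base pole) whose letters are constants: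
* `RebaseNest.nlo/nhi` — the bound data of the clean nest, `RebaseNest.mem_nDom`;
* `RebaseNest.IsNest s M i j A B T p a` — `s` is the clean nest over the base cell `cell M` with
  base-factor data `T` (`n₁ = 0`, `n₂ = 1`), numerator `p`, constant letters `a`, bounded domain;
* the elementary moves in this language: `IsNest.good_sep` (separable pair, `nestSection`),
  `IsNest.good_of_dom_empty/good_empty`, `IsNest.rowSplit` (cut the base at a rational point,
  `RebasePos.cutBase`), `IsNest.reflect` (`t ↦ −t` on both fibres, `RebasePos.pull` with
  `μ = −1`: the nesting order is reversed), `RebaseNest.shear` (joint shear along the common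
  letter slope `λ`, `RebasePos.pull` with `μ = 1, α = λ`: the letters become constants),
  `IsNest.cell_bound` (the base cell is bounded as soon as every fibre is non-empty).

References: M. Kontsevich, D. Zagier, *Periods* (2001), §1.2, rules (1a), (2).
-/

noncomputable section

open Set MeasureTheory MvPolynomial
open Literature.NumberTheory.Transcendental Literature.ModelTheory.ExponentialFields

namespace Summit.KontsevichZagierPeriods.ArrangementNormalForm.JanusBands

namespace RebaseNest

open SeparatePos RebasePos RebaseZero

/-! ### The clean nest -/

/-- Lower bounds of the clean nest `A < tᵢ < tⱼ`: the form `A` under `i`, the fibre `i` under `j`. -/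
def nlo (i : Fin 2) (A : Cf) : Fin 2 → Fin 2 ⊕ Cf := fun l => if l = i then Sum.inr A else Sum.inl i

/-- Upper bounds of the clean nest `tᵢ < tⱼ < B`: the form `B` over `j`, the fibre `j` over `i`. -/
def nhi (j : Fin 2) (Bd : Cf) : Fin 2 → Fin 2 ⊕ Cf := fun l => if l = j then Sum.inr Bd else Sum.inl j

/-- The lower bound of the inner fibre. -/
@[simp] theorem nlo_self (i : Fin 2) (A : Cf) : nlo i A i = Sum.inr A := if_pos rfl

/-- The lower bound of the outer fibre is the inner fibre. -/
theorem nlo_of_ne {i j : Fin 2} (h : i ≠ j) (A : Cf) : nlo i A j = Sum.inl i := if_neg h.symm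

/-- The upper bound of the outer fibre. -/
@[simp] theorem nhi_self (j : Fin 2) (Bd : Cf) : nhi j Bd j = Sum.inr Bd := if_pos rfl

/-- The upper bound of the inner fibre is the outer fibre. -/
theorem nhi_of_ne {i j : Fin 2} (h : i ≠ j) (Bd : Cf) : nhi j Bd i = Sum.inl j := if_neg h

/-- Bound data with the clean-nest equations are the clean-nest bound data. -/
theorem eq_nlo_nhi {i j : Fin 2} (hij : i ≠ j) {lo hi : Fin 2 → Fin 2 ⊕ Cf} {A Bd : Cf}
    (hloi : lo i = Sum.inr A) (hhii : hi i = Sum.inl j) (hloj : lo j = Sum.inl i)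
    (hhij : hi j = Sum.inr Bd) : lo = nlo i A ∧ hi = nhi j Bd := by
  constructor <;> funext l <;> rcases fin_two_eq_or hij l with rfl | rfl
  · rw [hloi, nlo_self]
  · rw [hloj, nlo_of_ne hij]
  · rw [hhii, nhi_of_ne hij]
  · rw [hhij, nhi_self]

variable {m' : ℕ}

/-- The rows of the literal text cut out the base cell. -/
theorem rows_iff (M : Fin m' → Cf) (z : Fin (0 + 1 + 2) → ℝ) :
    (∀ r, 0 < affF 0 2 (M r) z) ↔ yv z ∈ cell M := by
  simp only [affF_eq, cell, mem_setOf_eq]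

/-- Membership in the clean nest. -/
theorem mem_nDom {i j : Fin 2} (hij : i ≠ j) (M : Fin m' → Cf) (A Bd : Cf) (z : Fin (0 + 1 + 2) → ℝ) :
    z ∈ gDom 0 2 m' M (nlo i A) (nhi j Bd) ↔
      yv z ∈ cell M ∧ ev A (yv z) < tv z i ∧ tv z i < tv z j ∧ tv z j < ev Bd (yv z) := by
  rw [mem_nest M (nlo i A) (nhi j Bd) hij A Bd (nlo_self i A) (nhi_of_ne hij Bd) (nlo_of_ne hij A)
    (nhi_self j Bd), affF_eq, affF_eq, rows_iff]
  exact ⟨fun h => ⟨h.1, h.2.1.1, h.2.1.2, h.2.2.2⟩, fun h => ⟨h.1, ⟨h.2.1, h.2.2.1⟩, h.2.2.1, h.2.2.2⟩⟩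

/-- `s` is the CLEAN NESTED PAIR `A < tᵢ < tⱼ < B` over the base cell `cell M`, with base-factor
data `T` (simple base pole: `n₁ = 0`, `n₂ = 1`), numerator `p` and CONSTANT letters `a`, on a
bounded domain. [folklore] -/
structure IsNest (s : KZ.IntegralRep (0 + 1 + 2)) {m' : ℕ} (M : Fin m' → Cf) (i j : Fin 2) (A Bd : Cf)
    (T : BData) (p : MvPolynomial (Fin 0) ℚ) (a : Fin 2 → Option Cf) : Prop where
  /-- the two fibres -/
  ne : i ≠ j
  /-- the domain is the clean nest -/
  dom : s.domain = gDom 0 2 m' M (nlo i A) (nhi j Bd)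
  /-- the integrand is the literal one -/
  int : EqOn s.integrand (glitB T p a) s.domain
  /-- no numerator power of the base -/
  n1 : T.n₁ = 0
  /-- simple base pole -/
  n2 : T.n₂ = 1
  /-- constant letters -/
  a0 : ∀ l c, a l = some c → c.1 (Fin.last 0) = 0
  /-- bounded domain -/
  bdd : Bornology.IsBounded s.domain

variable {s : KZ.IntegralRep (0 + 1 + 2)} {M : Fin m' → Cf} {i j : Fin 2} {A Bd : Cf} {T : BData}
  {p : MvPolynomial (Fin 0) ℚ} {a : Fin 2 → Option Cf}

/-- Membership in the domain of a clean nest. -/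
theorem IsNest.mem (h : IsNest s M i j A Bd T p a) (z : Fin (0 + 1 + 2) → ℝ) : z ∈ s.domain ↔
    yv z ∈ cell M ∧ ev A (yv z) < tv z i ∧ tv z i < tv z j ∧ tv z j < ev Bd (yv z) := by
  rw [h.dom, mem_nDom h.ne]

/-! ### Elementary goodness -/

/-- **Separable pairs are good**: a constant `κ` with `A ≤ κ ≤ B` on the base cell is a
letter-parallel section (`RebaseNest.nestSection`). -/
theorem IsNest.good_sep (h : IsNest s M i j A Bd T p a) (κ : ℚ)
    (hκ : ∀ y ∈ cell M, ev A y ≤ κ ∧ (κ : ℝ) ≤ ev Bd y) : Good 2 (KZ.of s) := by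
  have hS : ∀ z : Fin (0 + 1 + 2) → ℝ, affF 0 2 (RebaseZero.mk 0 κ) z = κ := fun z => by
    rw [affF_eq, ev_mk, Rat.cast_zero, zero_mul, zero_add]
  refine nestSection s M T.L T.e p T.ℓ₁ T.ℓ₂ a (nlo i A) (nhi j Bd) (Or.inl h.n1) h.bdd h.dom h.int h.ne
    A Bd (RebaseZero.mk 0 κ) 0 (nlo_self i A) (nhi_of_ne h.ne Bd) (nlo_of_ne h.ne A) (nhi_self j Bd) h.a0 rfl
    (fun z hz => ?_) (fun z hz => ?_)
  · rw [hS, affF_eq]; exact (hκ _ ((rows_iff M z).1 hz)).1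
  · rw [hS, affF_eq]; exact (hκ _ ((rows_iff M z).1 hz)).2

/-- A representation with empty domain is good. -/
theorem good_of_dom_empty {k : ℕ} (r : KZ.IntegralRep (0 + 1 + k)) (he : ∀ z, z ∉ r.domain) :
    Good k (KZ.of r) := by
  refine good_of_mem_relations (KZ.of_mem_relations_of_volume_eq_zero r ?_)
  rw [Set.eq_empty_of_forall_notMem he, measure_empty]

/-- **Empty fibres**: if `B ≤ A` on the base cell, the clean nest is good (empty domain). -/
theorem IsNest.good_empty (h : IsNest s M i j A Bd T p a) (he : ∀ y ∈ cell M, ev Bd y ≤ ev A y) :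
    Good 2 (KZ.of s) :=
  good_of_dom_empty s fun z hz => by
    obtain ⟨hy, h1, h2, h3⟩ := (h.mem z).1 hz
    linarith [he _ hy]

/-- **Empty base cell**: a clean nest over an empty base cell is good. -/
theorem IsNest.good_cell_empty (h : IsNest s M i j A Bd T p a) (he : ∀ y, y ∉ cell M) :
    Good 2 (KZ.of s) :=
  good_of_dom_empty s fun z hz => he _ ((h.mem z).1 hz).1

/-! ### Cutting the base -/

/-- **Cutting the base cell at a rational point** (rule 1a, `RebasePos.cutBase`): if both pieces
(extra row `±q`) are good, so is the clean nest. -/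
theorem IsNest.rowSplit (h : IsNest s M i j A Bd T p a) (q : Cf) (hq : q ≠ 0)
    (h₁ : ∀ s₁ : KZ.IntegralRep (0 + 1 + 2), IsNest s₁ (Fin.snoc M q : Fin (m' + 1) → Cf) i j A Bd T p a →
      Good 2 (KZ.of s₁))
    (h₂ : ∀ s₂ : KZ.IntegralRep (0 + 1 + 2), IsNest s₂ (Fin.snoc M (-q) : Fin (m' + 1) → Cf) i j A Bd T p a →
      Good 2 (KZ.of s₂)) : Good 2 (KZ.of s) := by
  obtain ⟨s₁, s₂, hm₁, hm₂, hi₁, hi₂, hd₁, hd₂, hrel⟩ := cutBase s M (nlo i A) (nhi j Bd) h.dom q hq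
  have hs₁ : s₁.domain ⊆ s.domain := fun z hz => ((hm₁ z).1 hz).1
  have hs₂ : s₂.domain ⊆ s.domain := fun z hz => ((hm₂ z).1 hz).1
  refine good_of_rel3 hrel (h₁ s₁ ⟨h.ne, hd₁, fun z hz => ?_, h.n1, h.n2, h.a0, h.bdd.subset hs₁⟩)
    (h₂ s₂ ⟨h.ne, hd₂, fun z hz => ?_, h.n1, h.n2, h.a0, h.bdd.subset hs₂⟩)
  · rw [hi₁]; exact h.int (hs₁ hz)
  · rw [hi₂]; exact h.int (hs₂ hz)

/-- The base cell of a clean nest with NON-EMPTY fibres is bounded (it is the projection of the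
domain: lift `y` to the point with the fibres at one and two thirds of `(A, B)`). -/
theorem IsNest.cell_bound (h : IsNest s M i j A Bd T p a) (hAB : ∀ y ∈ cell M, ev A y < ev Bd y) :
    ∃ R : ℝ, ∀ y ∈ cell M, |y| ≤ R := by
  obtain ⟨R, hR⟩ := h.bdd.exists_norm_le
  refine ⟨R, fun y hy => ?_⟩
  have hlt := hAB y hy
  set z : Fin (0 + 1 + 2) → ℝ := Function.update (Function.update (fun _ => y) (tIdx i)
    ((2 * ev A y + ev Bd y) / 3)) (tIdx j) ((ev A y + 2 * ev Bd y) / 3) with hzdef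
  have hyv : yv z = y := by
    simp only [yv, hzdef, Function.update_of_ne (yIdx_ne_tIdx j), Function.update_of_ne (yIdx_ne_tIdx i)]
  have hti : tv z i = (2 * ev A y + ev Bd y) / 3 := by
    simp only [tv, hzdef, Function.update_of_ne (tIdx_injective.ne h.ne), Function.update_self]
  have htj : tv z j = (ev A y + 2 * ev Bd y) / 3 := by
    simp only [tv, hzdef, Function.update_self]
  have hz : z ∈ s.domain := by
    rw [h.mem, hyv, hti, htj]
    exact ⟨hy, by linarith, by linarith, by linarith⟩
  have h1 := norm_le_pi_norm z (yIdx 2)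
  rw [Real.norm_eq_abs, show z (yIdx 2) = y from hyv] at h1
  exact h1.trans (hR _ hz)

/-! ### Joint pull-backs of both fibres -/

/-- Constant pull-back data are linked-compatible. -/
theorem hlink_const (μ₀ α₀ : ℚ) (lo hi : Fin 2 → Fin 2 ⊕ Cf) : ∀ l l' : Fin 2,
    (lo l = Sum.inl l' ∨ hi l = Sum.inl l') → (fun _ : Fin 2 => μ₀) l = (fun _ : Fin 2 => μ₀) l' ∧
      (fun _ : Fin 2 => α₀) l = (fun _ : Fin 2 => α₀) l' ∧
      (fun _ : Fin 2 => (0 : (Fin 0 → ℚ) × ℚ)) l = (fun _ : Fin 2 => (0 : (Fin 0 → ℚ) × ℚ)) l' :=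
  fun _ _ _ => ⟨rfl, rfl, rfl⟩

/-- The reflected lower bounds of a clean nest: the clean nest in the reversed order. -/
theorem pullLo_reflect (hij : i ≠ j) (A Bd : Cf) :
    pullLo (fun _ : Fin 2 => (-1 : ℚ)) (fun _ => 0) (fun _ => 0) (nlo i A) (nhi j Bd) = nlo j (-Bd) := by
  funext l
  simp only [pullLo, show ¬ (0 : ℚ) < -1 by norm_num, if_false, pullC_neg_one]
  rcases fin_two_eq_or hij l with rfl | rfl
  · rw [nhi_of_ne hij, nlo_of_ne hij.symm]; rfl
  · rw [nhi_self, nlo_self]; rfl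

/-- The reflected upper bounds of a clean nest: the clean nest in the reversed order. -/
theorem pullHi_reflect (hij : i ≠ j) (A Bd : Cf) :
    pullHi (fun _ : Fin 2 => (-1 : ℚ)) (fun _ => 0) (fun _ => 0) (nlo i A) (nhi j Bd) = nhi i (-A) := by
  funext l
  simp only [pullHi, show ¬ (0 : ℚ) < -1 by norm_num, if_false, pullC_neg_one]
  rcases fin_two_eq_or hij l with rfl | rfl
  · rw [nlo_self, nhi_self]; rfl
  · rw [nlo_of_ne hij, nhi_of_ne hij.symm]; rfl

/-- **Reflection `t ↦ −t` of both fibres** (rule 2): the clean nest `A < tᵢ < tⱼ < B` becomes the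
clean nest `−B < tⱼ < tᵢ < −A` (roles of the fibres exchanged), the letters are negated. -/
theorem IsNest.reflect (h : IsNest s M i j A Bd T p a) : ∃ s' : KZ.IntegralRep (0 + 1 + 2),
    IsNest s' M j i (-Bd) (-A) T (C (pullQ (fun _ : Fin 2 => (-1 : ℚ)) a) * p) (fun l => (a l).map Neg.neg) ∧
      KZ.of s - KZ.of s' ∈ KZ.relations := by
  obtain ⟨s', -, hbd', hdom', hint', hrel⟩ := pull (fun _ : Fin 2 => (-1 : ℚ)) (fun _ => 0) (fun _ => 0)
    s M T.L T.e p T.ℓ₁ T.ℓ₂ T.n₁ T.n₂ a (nlo i A) (nhi j Bd) h.bdd h.dom h.int (fun _ => by norm_num)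
    (hlink_const (-1) 0 _ _)
  have ha : pullA (fun _ : Fin 2 => (-1 : ℚ)) (fun _ => 0) (fun _ => 0) a = fun l => (a l).map Neg.neg := by
    funext l; simp only [pullA, pullC_neg_one]
  refine ⟨s', ⟨h.ne.symm, ?_, ?_, h.n1, h.n2, fun l c hc => ?_, hbd'⟩, hrel⟩
  · rw [hdom', pullLo_reflect h.ne, pullHi_reflect h.ne]
  · rw [← ha]; exact hint'
  · rcases h' : a l with _ | c₀
    · simp [h'] at hc
    · simp only [h', Option.map_some, Option.some.injEq] at hc
      rw [← hc, neg_fst, h.a0 l c₀ h', neg_zero]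

/-- The sheared bounds of a clean nest. -/
theorem pullLo_shear (lam : ℚ) (A Bd : Cf) :
    pullLo (fun _ : Fin 2 => (1 : ℚ)) (fun _ => lam) (fun _ => 0) (nlo i A) (nhi j Bd) =
      nlo i (pullC 1 lam 0 A) := by
  funext l
  simp only [pullLo, zero_lt_one, if_true, nlo]
  split_ifs <;> rfl

/-- The sheared bounds of a clean nest. -/
theorem pullHi_shear (lam : ℚ) (A Bd : Cf) :
    pullHi (fun _ : Fin 2 => (1 : ℚ)) (fun _ => lam) (fun _ => 0) (nlo i A) (nhi j Bd) =
      nhi j (pullC 1 lam 0 Bd) := by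
  funext l
  simp only [pullHi, zero_lt_one, if_true, nhi]
  split_ifs <;> rfl

/-- **Joint shear along the common letter slope** (rule 2, `tₗ ↦ tₗ + λ y` on both fibres): a
clean nest with letters of common `y`-slope `λ` and a simple base pole becomes a clean nest with
CONSTANT letters (`RebaseNest.IsNest`). -/
theorem shear {m n₁ n₂ : ℕ} (s : KZ.IntegralRep (0 + 1 + 2)) (M : Fin m' → Cf)
    (L : Fin m → (Fin 0 → ℚ) × ℚ) (e : Fin m → ℕ) (p : MvPolynomial (Fin 0) ℚ) (ℓ₁ ℓ₂ : (Fin 0 → ℚ) × ℚ)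
    (a : Fin 2 → Option Cf) (hij : i ≠ j) (A Bd : Cf) (h1 : n₁ = 0) (hn : n₂ = 1)
    (hbd : Bornology.IsBounded s.domain) (hdom : s.domain = gDom 0 2 m' M (nlo i A) (nhi j Bd))
    (hint : EqOn s.integrand (glit 0 2 p L e ℓ₁ ℓ₂ n₁ n₂ a) s.domain) (lam : ℚ)
    (ha : ∀ l c, a l = some c → c.1 (Fin.last 0) = lam) :
    ∃ s' : KZ.IntegralRep (0 + 1 + 2), IsNest s' M i j (pullC 1 lam 0 A) (pullC 1 lam 0 Bd)
      ⟨m, L, e, ℓ₁, ℓ₂, n₁, n₂⟩ (C (pullQ (fun _ : Fin 2 => (1 : ℚ)) a) * p)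
      (pullA (fun _ : Fin 2 => (1 : ℚ)) (fun _ => lam) (fun _ => 0) a) ∧
      KZ.of s - KZ.of s' ∈ KZ.relations := by
  obtain ⟨s', -, hbd', hdom', hint', hrel⟩ := pull (fun _ : Fin 2 => (1 : ℚ)) (fun _ => lam) (fun _ => 0)
    s M L e p ℓ₁ ℓ₂ n₁ n₂ a (nlo i A) (nhi j Bd) hbd hdom hint (fun _ => one_ne_zero) (hlink_const 1 lam _ _)
  refine ⟨s', ⟨hij, ?_, hint', h1, hn, fun l c hc => ?_, hbd'⟩, hrel⟩
  · rw [hdom', pullLo_shear, pullHi_shear]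
  · rcases h' : a l with _ | c₀
    · simp [pullA, h'] at hc
    · simp only [pullA, h', Option.map_some, Option.some.injEq] at hc
      rw [← hc, pullC_fst_last, ha l c₀ h', sub_self, zero_div]

end RebaseNest

/-- Registered support goal of this file (part of `rebaseSimpleZero_nestedCommon`): the joint
shear of a clean nested pair along the common letter slope (`RebaseNest.shear`). -/
theorem rebaseSimpleZero_nestedShear (m m' n₁ n₂ : ℕ) (s : KZ.IntegralRep (0 + 1 + 2)) (M : Fin m' → (Fin (0 + 1) → ℚ) × ℚ) (L : Fin m → (Fin 0 → ℚ) × ℚ) (e : Fin m → ℕ) (p : MvPolynomial (Fin 0) ℚ) (ℓ₁ ℓ₂ : (Fin 0 → ℚ) × ℚ) (a : Fin 2 → Option ((Fin (0 + 1) → ℚ) × ℚ)) (i j : Fin 2) (hij : i ≠ j) (A Bd : (Fin (0 + 1) → ℚ) × ℚ) (h1 : n₁ = 0) (hn : n₂ = 1) (hbd : Bornology.IsBounded s.domain) (hdom : s.domain = SeparatePos.gDom 0 2 m' M (RebaseNest.nlo i A) (RebaseNest.nhi j Bd)) (hint : EqOn s.integrand (RebasePos.glit 0 2 p L e ℓ₁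 ℓ₂ n₁ n₂ a) s.domain) (lam : ℚ) (ha : ∀ l c, a l = some c → c.1 (Fin.last 0) = lam) : ∃ s' : KZ.IntegralRep (0 + 1 + 2), RebaseNest.IsNest s' M i j (RebasePos.pullC 1 lam 0 A) (RebasePos.pullC 1 lam 0 Bd) ⟨m, L, e, ℓ₁, ℓ₂, n₁, n₂⟩ (MvPolynomial.C (RebasePos.pullQ (fun _ : Fin 2 => (1 : ℚ)) a) * p) (RebasePos.pullA (fun _ : Fin 2 => (1 : ℚ)) (fun _ => lam) (fun _ => 0) a) ∧ KZ.of s - KZ.of s' ∈ KZ.relations :=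
  RebaseNest.shear s M L e p ℓ₁ ℓ₂ a hij A Bd h1 hn hbd hdom hint lam ha

end Summit.KontsevichZagierPeriods.ArrangementNormalForm.JanusBands
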